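import Literature.NumberTheory.Automorphic.UnitaryGroupTruncatedKernelClassBorelCount
import Literature.NumberTheory.Automorphic.UnitaryGroupSubgroupCosetSumUnfolding
import HarnessLib

/-!
# Unfolding Arthur's `j`-kernel of a regular hyperbolic class of `U(J₃)` over `G_γ(F)\G(𝔸_F)`:
# `∫_{G(F)\G(𝔸)} Σ_{δ ∈ G_γ(F)\G(F)} f(x⁻¹δ⁻¹γδx)·u_T(δx) dx = c_μ ∫_{G(𝔸)} β(g) f(g⁻¹γg) u_T(g) dν_G(g)`
(Rogawski, *Automorphic Representations of Unitary Groups in Three Variables* (1990), §6.1 pp. 79–81,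
(6.1.1)–(6.1.3): «`J^T_𝔬(f)` can be expressed as a weighted orbital integral»; Arthur, *A trace formula for
reductive groups I*, Duke Math. J. 45 (1978), §8: the unramified classes `𝔬` unfold over `G_γ(ℚ)\G(𝔸)`;
Gelbart (1975), §9.B (9.40)–(9.45) for the unfolding of a coset sum)

Topic `NumberTheory/Automorphic`; namespace `Literature.NumberTheory.Automorphic.UnitaryGroup`. THEOREMS ONLY
over accepted tree modules: no definition, no named fact, no instance, no notation, no `sorry`. Row (L5-ii)
(W2-c) «unfolding of the `j`-kernel» of the T1-qs LAW 5 road of `Cruxes/H413/Lines/F0_T1InnerFormTraceIdentity.lean`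
(cell `pub/hodgecm-mathlib`, crux H413). Letters of ★ p822003 `UnitaryGroupTruncatedKernelClassBorelCount`
(`truncatedKernelClass_eq_tsum_mul_weight_sub_sum_of_hyperbolic`) VERBATIM: quadratic `E/F` with involution `c`,
`c² = 1`; the regular hyperbolic torus point `γ♯ = ι(g₀)`, `hg₀ : g₀ = d(a, b, (c a)⁻¹)`, `c a · a ≠ 1`, `c b · b = 1`;
the Weyl element `w♯ = ι(w)`, `hw : w = J₃`; a conjugation-invariant class map `cl` (★ `IsConjInvariant`) whose
class `𝔬 = cl⁻¹{i}` contains `γ♯` and a section `sec` with `(sec γ′)⁻¹ γ♯ (sec γ′) = γ′` (★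
`exists_conj_eq_mk_toAdelic_of_hyperbolic`); Arthur's weight in the `ite` spelling of ★ p822003,
`u_T(y) = 1 − [T < H(y)] − [T < H(w♯ y)]` (`H = borelHeight`), written INLINE. The rational centraliser is
`G_γ(F) := Subgroup.centralizer {γ♯} ≤ G(F)` (`= T(F)`, inside `B(F)` by ★ `mem_arithmeticBorel_of_commute_hyperbolic`).

* §1 **`centralizer_le_arithmeticBorel_of_hyperbolic`** (`G_γ(F) ≤ B(F)`), `borelHeight_mul_eq_of_mem_centralizer`,
  `borelHeight_weyl_mul_mul_eq_of_mem_centralizer` (`H(δy) = H(y)`, `H(w♯δy) = H(w♯y)` for `δ ∈ G_γ(F)`: regular rigidity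
  puts `δ` and `w♯δw♯⁻¹` in `B(F)`, and `B(F)` fixes the height ★ `borelHeight_arithmeticBorel_mul`) and
  **`jWeight_mul_eq_of_mem_centralizer`** — THE WEIGHT `u_T` IS LEFT-`G_γ(F)`-INVARIANT (token (γ) of the road).
* §2 (pure group theory, any group `Γ`, any `γ₁ ∈ Γ`; after two private plumbing lemmas
  `a⁻¹γ₁a = b⁻¹γ₁b ↔ b a⁻¹ ∈ C(γ₁)`) **`tsum_fiber_eq_tsum_quotient_centralizer`** — RE-INDEXING A CLASS BY THE
  CENTRALISER COSETS: for a class `𝔬 = cl⁻¹{i} ∋ γ₁` of a conjugation-invariant `cl`, a section `sec` of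
  `δ ↦ δ⁻¹γ₁δ` over `𝔬` and a summand `Φ γ′ δ` unchanged under `δ ↦ λδ` (`λ ∈ C(γ₁)`):
  `Σ'_{γ′ ∈ 𝔬} Φ γ′ (sec γ′) = Σ'_{q ∈ C(γ₁)\Γ} Φ (q̃⁻¹γ₁q̃) q̃` (the bijection `C(γ₁)δ ↦ δ⁻¹γ₁δ`); then for `U(J₃)`:
  **`tsum_fiber_jKernel_eq_tsum_quotient`** — `Σ'_{γ′ ∈ 𝔬} f(x⁻¹γ′x)·u_T(sec γ′ · x) = Σ'_{q ∈ G_γ(F)\G(F)} ψ_T(q̃ x)`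
  with `ψ_T(y) = f(y⁻¹γ♯y)·u_T(y)`, and its `[0, ∞]` twin **`tsum_fiber_jKernel_enorm_eq_tsum_quotient`** for
  `‖f(x⁻¹γ′x)‖ₑ·‖u_T(sec γ′ x)‖ₑ`; **`quotFun_jKernel_eq_tsum_quotient`** — on the automorphic quotient the descended
  `j`-kernel `[g] ↦ J_T(g⁻¹)` (★ `AdelicGroupData.quotFun`) IS the coset sum `Σ'_q ψ_T(q̃ x̃⁻¹)` of ★ FILE A
  `UnitaryGroupSubgroupCosetSumUnfolding` at `Λ := G_γ(F)`.
* §3 **`lintegral_jKernel_enorm_eq_unfoldingConstant_mul_lintegral`** — `[0, ∞]` FIRST: for an automorphic measure `μ`,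
  an inversion-invariant Haar measure `ν_G` and every covering weight `β` of `G_γ(F)♯`,
  `∫⁻_X Σ'_{γ′ ∈ 𝔬} ‖f(x̃ γ′ x̃⁻¹)‖ₑ‖u_T(sec γ′ x̃⁻¹)‖ₑ dμ(x) = c_μ · ∫⁻_{G(𝔸)} β(g)‖f(g⁻¹γ♯g)‖ₑ‖u_T(g)‖ₑ dν_G(g)`,
  `c_μ = unfoldingConstant G(F) count μ ν_G` (★ LAW 4's constant).
* §4 **`integrable_quotFun_jKernel_and_integral_eq_mul_integral`** — THE BOCHNER UNFOLDING of the `j`-kernel: under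
  `hfin : ∫⁻ β(g)‖f(g⁻¹γ♯g)·u_T(g)‖ₑ dν_G < ∞` the descended `j`-kernel is `μ`-integrable and
  `∫_X quotFun J_T dμ = c_μ · ∫_{G(𝔸)} (β g).toReal • (f(g⁻¹γ♯g)·u_T(g)) dν_G(g)` — Rogawski's passage from `J^T_𝔬(f)`
  to the weighted orbital integral before the `A_M`-integration [(6.1.1)]. `hfin` is NOT discharged here: it is the
  `T(𝔸)`-fibre step ((W3) ★ `UnitaryGroupTorusRankOneInterval` in the fibre, sequel file
  `UnitaryGroupHyperbolicWeightedOrbitalUnfolding`), which also evaluates the right-hand side as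
  `C·∫_{T(𝔸)\G(𝔸)} f(y⁻¹γ♯y)(2 log T − log H(y) − log H(w♯y))` [(6.1.2)–(6.1.3)].

## References

* J. D. Rogawski, *Automorphic Representations of Unitary Groups in Three Variables*, Ann. of Math. Stud. 123
  (1990), §2.2 (p. 13), §6.1 (pp. 79–81) [Rogawski1990].
* J. Arthur, *A trace formula for reductive groups I: terms associated to classes in `G(ℚ)`*, Duke Math. J. 45
  (1978), §8 [Arthur1978TraceFormulaI].
* S. Gelbart, *Automorphic forms on adele groups*, Ann. of Math. Stud. 83 (1975), §9.B (9.40)–(9.45) [Gelbart1975].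
-/

set_option autoImplicit false

noncomputable section

open MeasureTheory Measure NumberField IsDedekindDomain Set Matrix
open Literature.MeasureTheory.Group
open scoped NNReal ENNReal MatrixGroups

namespace Literature.NumberTheory.Automorphic

namespace UnitaryGroup

variable {F E : Type} [Field F] [NumberField F] [Field E] [NumberField E] [Algebra F E]
  {c : E ≃ₐ[F] E}

/-! ## §1 The rational centraliser of a regular hyperbolic element fixes Arthur's weight -/

section Weight

/-- **`G_γ(F) ≤ B(F)`** for the regular hyperbolic `γ♯ = ι(d(a, b, (ca)⁻¹))`: an element of `G(F)` commuting with
`γ♯` is diagonal, hence upper triangular (★ `mem_arithmeticBorel_of_commute_hyperbolic`; Rogawski §3.6: the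
centraliser of a regular element of `M` is `M`). [cite: Rogawski1990, §3.6 (p. 27) and §6.1 (p. 79)] -/
theorem centralizer_le_arithmeticBorel_of_hyperbolic (hc : c * c = 1) {a b : Eˣ} (ha : c (a : E) * (a : E) ≠ 1)
    (hb : c (b : E) * (b : E) = 1) {g₀ w : (quasiSplit F E c 3).Rational}
    (hg₀ : ((g₀.1 : GL (Fin 3) E) : Matrix (Fin 3) (Fin 3) E) = !![(a : E), 0, 0; 0, b, 0; 0, 0, (c (a : E))⁻¹])
    (hw : ((w.1 : GL (Fin 3) E) : Matrix (Fin 3) (Fin 3) E) = !![(0 : E), 0, 1; 0, 1, 0; 1, 0, 0]) :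
    Subgroup.centralizer {(⟨(quasiSplit F E c 3).toAdelic g₀, g₀, rfl⟩ : (quasiSplit F E c 3).arithmeticSubgroup)} ≤
      arithmeticBorel F E c 3 := fun _ hδ =>
  (mem_arithmeticBorel_of_commute_hyperbolic hc ha hb hg₀ hw (Subgroup.mem_centralizer_singleton_iff.1 hδ)).1

/-- `H(δ y) = H(y)` for `δ ∈ G_γ(F)` (`δ ∈ B(F)` by §1 and `B(F)` fixes the Borel height ★
`borelHeight_arithmeticBorel_mul`). [cite: Rogawski1990, §6.1 (pp. 79–81)] -/
theorem borelHeight_mul_eq_of_mem_centralizer (hc : c * c = 1) {a b : Eˣ} (ha : c (a : E) * (a : E) ≠ 1)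
    (hb : c (b : E) * (b : E) = 1) {g₀ w : (quasiSplit F E c 3).Rational}
    (hg₀ : ((g₀.1 : GL (Fin 3) E) : Matrix (Fin 3) (Fin 3) E) = !![(a : E), 0, 0; 0, b, 0; 0, 0, (c (a : E))⁻¹])
    (hw : ((w.1 : GL (Fin 3) E) : Matrix (Fin 3) (Fin 3) E) = !![(0 : E), 0, 1; 0, 1, 0; 1, 0, 0])
    {δ : (quasiSplit F E c 3).arithmeticSubgroup}
    (hδ : δ ∈ Subgroup.centralizer
      {(⟨(quasiSplit F E c 3).toAdelic g₀, g₀, rfl⟩ : (quasiSplit F E c 3).arithmeticSubgroup)})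
    (y : (quasiSplit F E c 3).Adelic) :
    borelHeight ((δ : (quasiSplit F E c 3).Adelic) * y) = borelHeight y :=
  borelHeight_arithmeticBorel_mul (centralizer_le_arithmeticBorel_of_hyperbolic hc ha hb hg₀ hw hδ) y

/-- `H(w♯ δ y) = H(w♯ y)` for `δ ∈ G_γ(F)`: `w♯ δ w♯⁻¹ ∈ B(F)` (★ `mem_arithmeticBorel_of_commute_hyperbolic`, second
conjunct: `w` normalises the diagonal torus) and `w♯ δ y = (w♯ δ w♯⁻¹)(w♯ y)`. [cite: Rogawski1990, §6.1 (pp. 79–81)] -/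
theorem borelHeight_weyl_mul_mul_eq_of_mem_centralizer (hc : c * c = 1) {a b : Eˣ} (ha : c (a : E) * (a : E) ≠ 1)
    (hb : c (b : E) * (b : E) = 1) {g₀ w : (quasiSplit F E c 3).Rational}
    (hg₀ : ((g₀.1 : GL (Fin 3) E) : Matrix (Fin 3) (Fin 3) E) = !![(a : E), 0, 0; 0, b, 0; 0, 0, (c (a : E))⁻¹])
    (hw : ((w.1 : GL (Fin 3) E) : Matrix (Fin 3) (Fin 3) E) = !![(0 : E), 0, 1; 0, 1, 0; 1, 0, 0])
    {δ : (quasiSplit F E c 3).arithmeticSubgroup}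
    (hδ : δ ∈ Subgroup.centralizer
      {(⟨(quasiSplit F E c 3).toAdelic g₀, g₀, rfl⟩ : (quasiSplit F E c 3).arithmeticSubgroup)})
    (y : (quasiSplit F E c 3).Adelic) :
    borelHeight ((quasiSplit F E c 3).toAdelic w * ((δ : (quasiSplit F E c 3).Adelic) * y)) =
      borelHeight ((quasiSplit F E c 3).toAdelic w * y) := by
  have h2 := (mem_arithmeticBorel_of_commute_hyperbolic hc ha hb hg₀ hw
    (Subgroup.mem_centralizer_singleton_iff.1 hδ)).2
  have e : (quasiSplit F E c 3).toAdelic w * ((δ : (quasiSplit F E c 3).Adelic) * y) =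
      (((⟨(quasiSplit F E c 3).toAdelic w, w, rfl⟩ * δ * (⟨(quasiSplit F E c 3).toAdelic w, w, rfl⟩)⁻¹ :
        (quasiSplit F E c 3).arithmeticSubgroup)) : (quasiSplit F E c 3).Adelic) *
        ((quasiSplit F E c 3).toAdelic w * y) := by
    rw [Subgroup.coe_mul, Subgroup.coe_mul, Subgroup.coe_inv]
    change _ = (quasiSplit F E c 3).toAdelic w * (δ : (quasiSplit F E c 3).Adelic) *
      ((quasiSplit F E c 3).toAdelic w)⁻¹ * ((quasiSplit F E c 3).toAdelic w * y)
    group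
  rw [e, borelHeight_arithmeticBorel_mul h2]

/-- **ARTHUR'S WEIGHT IS LEFT-`G_γ(F)`-INVARIANT**: for `δ ∈ G_γ(F)` and every `T`, `y`,
`1 − [T < H(δy)] − [T < H(w♯δy)] = 1 − [T < H(y)] − [T < H(w♯y)]` (the `ite` spelling of ★ p822003's `j`-kernel) —
the token that makes `f(y⁻¹γ♯y)·u_T(y)` descend to `G_γ(F)\G(𝔸)` [Rogawski §6.1: the weight is a function on
`M\G`]. [cite: Rogawski1990, §6.1 (6.1.1)] [cite: Arthur1978TraceFormulaI, §8] -/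
theorem jWeight_mul_eq_of_mem_centralizer (hc : c * c = 1) {a b : Eˣ} (ha : c (a : E) * (a : E) ≠ 1)
    (hb : c (b : E) * (b : E) = 1) {g₀ w : (quasiSplit F E c 3).Rational}
    (hg₀ : ((g₀.1 : GL (Fin 3) E) : Matrix (Fin 3) (Fin 3) E) = !![(a : E), 0, 0; 0, b, 0; 0, 0, (c (a : E))⁻¹])
    (hw : ((w.1 : GL (Fin 3) E) : Matrix (Fin 3) (Fin 3) E) = !![(0 : E), 0, 1; 0, 1, 0; 1, 0, 0])
    {δ : (quasiSplit F E c 3).arithmeticSubgroup}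
    (hδ : δ ∈ Subgroup.centralizer
      {(⟨(quasiSplit F E c 3).toAdelic g₀, g₀, rfl⟩ : (quasiSplit F E c 3).arithmeticSubgroup)})
    (T : ℝ≥0) (y : (quasiSplit F E c 3).Adelic) :
    ((1 : ℂ) - (if T < borelHeight ((δ : (quasiSplit F E c 3).Adelic) * y) then (1 : ℂ) else 0) -
        (if T < borelHeight ((quasiSplit F E c 3).toAdelic w * ((δ : (quasiSplit F E c 3).Adelic) * y))
          then (1 : ℂ) else 0)) =
      ((1 : ℂ) - (if T < borelHeight y then (1 : ℂ) else 0) -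
        (if T < borelHeight ((quasiSplit F E c 3).toAdelic w * y) then (1 : ℂ) else 0)) := by
  rw [borelHeight_mul_eq_of_mem_centralizer hc ha hb hg₀ hw hδ y,
    borelHeight_weyl_mul_mul_eq_of_mem_centralizer hc ha hb hg₀ hw hδ y]

end Weight

/-! ## §2 Re-indexing a class by the centraliser cosets -/

section Reindex

variable {Γ : Type*} [Group Γ] {ι : Type*}

/-- `a⁻¹ γ₁ a = b⁻¹ γ₁ b ↔ b a⁻¹ ∈ C(γ₁)` (pure group theory: the fibres of `δ ↦ δ⁻¹γ₁δ` are the right cosets of the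
centraliser; private plumbing). [folklore] -/
private theorem inv_mul_mul_eq_inv_mul_mul_iff_mem_centralizer (γ₁ a b : Γ) :
    a⁻¹ * γ₁ * a = b⁻¹ * γ₁ * b ↔ b * a⁻¹ ∈ Subgroup.centralizer {γ₁} := by
  rw [Subgroup.mem_centralizer_singleton_iff]
  constructor
  · intro h
    -- `b a⁻¹ γ₁ = γ₁ b a⁻¹`
    calc b * a⁻¹ * γ₁ = b * (a⁻¹ * γ₁ * a) * a⁻¹ := by group
      _ = b * (b⁻¹ * γ₁ * b) * a⁻¹ := by rw [h]
      _ = γ₁ * (b * a⁻¹) := by group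
  · intro h
    calc a⁻¹ * γ₁ * a = b⁻¹ * (b * a⁻¹ * γ₁) * a := by group
      _ = b⁻¹ * (γ₁ * (b * a⁻¹)) * a := by rw [h]
      _ = b⁻¹ * γ₁ * b := by group

/-- The right-coset relation of the centraliser, read on conjugates: `C(γ₁) a = C(γ₁) b ↔ a⁻¹γ₁a = b⁻¹γ₁b`
(`QuotientGroup.rightRel`; private plumbing). [folklore] -/
private theorem centralizer_rightRel_iff (γ₁ a b : Γ) :
    @Setoid.r _ (QuotientGroup.rightRel (Subgroup.centralizer {γ₁})) a b ↔ a⁻¹ * γ₁ * a = b⁻¹ * γ₁ * b := by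
  rw [QuotientGroup.rightRel_apply, inv_mul_mul_eq_inv_mul_mul_iff_mem_centralizer]

/-- **RE-INDEXING A CLASS BY THE CENTRALISER COSETS** (any group `Γ`). Let `cl : Γ → ι` be conjugation-invariant,
`γ₁ ∈ Γ` with `cl γ₁ = i`, `sec` a section of `δ ↦ δ⁻¹γ₁δ` over the class `𝔬 = cl⁻¹{i}`
(`(sec γ′)⁻¹ γ₁ (sec γ′) = γ′` — so `𝔬` is exactly the conjugacy class of `γ₁`), and `Φ γ′ δ` a summand which, on the
conjugators of `γ′ = δ⁻¹γ₁δ`, does not see left multiplication by the centraliser. Then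
`Σ'_{γ′ ∈ 𝔬} Φ γ′ (sec γ′) = Σ'_{q ∈ C(γ₁)\Γ} Φ (q̃⁻¹γ₁q̃) q̃` — the bijection `C(γ₁) δ ↦ δ⁻¹ γ₁ δ` of `C(γ₁)\Γ` onto
the class (Rogawski §2.2 ∕ Arthur §8: `K_𝔬(x,x) = Σ_{δ ∈ G_γ(F)\G(F)} f(x⁻¹δ⁻¹γδx)` for a class with trivial
«`ε`-structure»). [cite: Rogawski1990, §2.2 (p. 13) and §6.1 (p. 79)] [cite: Arthur1978TraceFormulaI, §8] -/
theorem tsum_fiber_eq_tsum_quotient_centralizer {α : Type*} [AddCommMonoid α] [TopologicalSpace α]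
    {cl : Γ → ι} (hcl : IsConjInvariant cl) {γ₁ : Γ} {i : ι} (hi : cl γ₁ = i)
    (sec : cl ⁻¹' {i} → Γ) (hsec : ∀ γ : cl ⁻¹' {i}, (sec γ)⁻¹ * γ₁ * sec γ = (γ : Γ))
    (Φ : Γ → Γ → α)
    (hΦ : ∀ (δ : Γ), ∀ l ∈ Subgroup.centralizer {γ₁}, Φ (δ⁻¹ * γ₁ * δ) (l * δ) = Φ (δ⁻¹ * γ₁ * δ) δ) :
    ∑' γ : cl ⁻¹' {i}, Φ (γ : Γ) (sec γ) =
      ∑' q : Quotient (QuotientGroup.rightRel (Subgroup.centralizer {γ₁})),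
        Φ (q.out⁻¹ * γ₁ * q.out) q.out := by
  classical
  -- the bijection `C(γ₁)\Γ ≃ 𝔬`, `q ↦ q̃⁻¹ γ₁ q̃`, inverse `γ′ ↦ C(γ₁) sec γ′`
  have hmem : ∀ δ : Γ, δ⁻¹ * γ₁ * δ ∈ cl ⁻¹' {i} := fun δ => by
    rw [Set.mem_preimage, Set.mem_singleton_iff, hcl.apply_inv_mul_mul, hi]
  set e : Quotient (QuotientGroup.rightRel (Subgroup.centralizer {γ₁})) ≃ cl ⁻¹' {i} :=
    { toFun := fun q => ⟨q.out⁻¹ * γ₁ * q.out, hmem q.out⟩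
      invFun := fun γ => Quotient.mk (QuotientGroup.rightRel (Subgroup.centralizer {γ₁})) (sec γ)
      left_inv := fun q => by
        conv_rhs => rw [← Quotient.out_eq q]
        refine Quotient.sound ?_
        change @Setoid.r _ (QuotientGroup.rightRel (Subgroup.centralizer {γ₁})) _ _
        rw [centralizer_rightRel_iff, hsec ⟨q.out⁻¹ * γ₁ * q.out, hmem q.out⟩]
      right_inv := fun γ => by
        apply Subtype.ext
        change (Quotient.mk (QuotientGroup.rightRel (Subgroup.centralizer {γ₁})) (sec γ)).out⁻¹ * γ₁ *
          (Quotient.mk (QuotientGroup.rightRel (Subgroup.centralizer {γ₁})) (sec γ)).out = (γ : Γ)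
        rw [← hsec γ]
        have h : Quotient.mk (QuotientGroup.rightRel (Subgroup.centralizer {γ₁})) (sec γ) =
            Quotient.mk (QuotientGroup.rightRel (Subgroup.centralizer {γ₁}))
              (Quotient.mk (QuotientGroup.rightRel (Subgroup.centralizer {γ₁})) (sec γ)).out :=
          (Quotient.out_eq _).symm
        exact ((centralizer_rightRel_iff γ₁ _ _).1 (Quotient.exact h)).symm } with he
  rw [← e.tsum_eq]
  refine tsum_congr fun q => ?_
  -- on the coset `q`, `sec (e q) = l q̃` with `l ∈ C(γ₁)`
  have hq : ((e q : cl ⁻¹' {i}) : Γ) = q.out⁻¹ * γ₁ * q.out := rfl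
  have hl : sec (e q) * q.out⁻¹ ∈ Subgroup.centralizer {γ₁} :=
    (inv_mul_mul_eq_inv_mul_mul_iff_mem_centralizer γ₁ q.out (sec (e q))).1
      (by rw [hsec (e q), hq])
  rw [hq, ← hΦ q.out _ hl, inv_mul_cancel_right]

end Reindex

/-! ## §2 (continued) The `j`-kernel of `U(J₃)` as a coset sum over `G_γ(F)\G(F)` -/

section JKernel

/-- **THE `j`-KERNEL AS A COSET SUM OVER `G_γ(F)\G(F)`**: with `ψ_T(y) := f(y⁻¹γ♯y)·(1 − [T<H(y)] − [T<H(w♯y)])`,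
`Σ'_{γ′ ∈ 𝔬} f(x⁻¹γ′x)·(1 − [T<H(sec γ′ · x)] − [T<H(w♯ · sec γ′ · x)]) = Σ'_{q ∈ G_γ(F)\G(F)} ψ_T(q̃ x)` — the left-hand side is
★ p822003's `j`-kernel (first summand of `truncatedKernelClass_eq_tsum_mul_weight_sub_sum_of_hyperbolic`), the right-hand
side the coset sum unfolded by ★ `UnitaryGroupSubgroupCosetSumUnfolding` at `Λ := G_γ(F)` [Rogawski (6.1.1):
`Σ_{δ ∈ M\G} f(x⁻¹δ⁻¹γδx)(…)`]. [cite: Rogawski1990, §6.1 (6.1.1)] [cite: Arthur1978TraceFormulaI, §8] -/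
theorem tsum_fiber_jKernel_eq_tsum_quotient (hc : c * c = 1) {a b : Eˣ} (ha : c (a : E) * (a : E) ≠ 1)
    (hb : c (b : E) * (b : E) = 1) {g₀ w : (quasiSplit F E c 3).Rational}
    (hg₀ : ((g₀.1 : GL (Fin 3) E) : Matrix (Fin 3) (Fin 3) E) = !![(a : E), 0, 0; 0, b, 0; 0, 0, (c (a : E))⁻¹])
    (hw : ((w.1 : GL (Fin 3) E) : Matrix (Fin 3) (Fin 3) E) = !![(0 : E), 0, 1; 0, 1, 0; 1, 0, 0])
    {ι : Type*} {cl : (quasiSplit F E c 3).arithmeticSubgroup → ι} (hcl : IsConjInvariant cl) {i : ι}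
    (hi : cl ⟨(quasiSplit F E c 3).toAdelic g₀, g₀, rfl⟩ = i)
    (sec : cl ⁻¹' {i} → (quasiSplit F E c 3).arithmeticSubgroup)
    (hsec : ∀ γ : cl ⁻¹' {i},
      (sec γ)⁻¹ * ⟨(quasiSplit F E c 3).toAdelic g₀, g₀, rfl⟩ * sec γ = (γ : (quasiSplit F E c 3).arithmeticSubgroup))
    (f : (quasiSplit F E c 3).Adelic → ℂ) (T : ℝ≥0) (x : (quasiSplit F E c 3).Adelic) :
    (∑' γ : cl ⁻¹' {i},
        f (x⁻¹ * ((γ : (quasiSplit F E c 3).arithmeticSubgroup) : (quasiSplit F E c 3).Adelic) * x) *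
          (1 - (if T < borelHeight (((sec γ : (quasiSplit F E c 3).arithmeticSubgroup) : (quasiSplit F E c 3).Adelic) * x)
                  then (1 : ℂ) else 0) -
               (if T < borelHeight ((((⟨(quasiSplit F E c 3).toAdelic w, w, rfl⟩ * sec γ :
                  (quasiSplit F E c 3).arithmeticSubgroup)) : (quasiSplit F E c 3).Adelic) * x) then (1 : ℂ) else 0))) =
      ∑' q : Quotient (QuotientGroup.rightRel (Subgroup.centralizer
          {(⟨(quasiSplit F E c 3).toAdelic g₀, g₀, rfl⟩ : (quasiSplit F E c 3).arithmeticSubgroup)})),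
        f (((((q.out : (quasiSplit F E c 3).arithmeticSubgroup)) : (quasiSplit F E c 3).Adelic) * x)⁻¹ *
            (quasiSplit F E c 3).toAdelic g₀ *
            ((((q.out : (quasiSplit F E c 3).arithmeticSubgroup)) : (quasiSplit F E c 3).Adelic) * x)) *
          ((1 : ℂ) - (if T < borelHeight ((((q.out : (quasiSplit F E c 3).arithmeticSubgroup)) :
                (quasiSplit F E c 3).Adelic) * x) then (1 : ℂ) else 0) -
            (if T < borelHeight ((quasiSplit F E c 3).toAdelic w *
                ((((q.out : (quasiSplit F E c 3).arithmeticSubgroup)) : (quasiSplit F E c 3).Adelic) * x))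
              then (1 : ℂ) else 0)) := by
  -- the summand as a function of (conjugate, conjugator)
  set Φ : (quasiSplit F E c 3).arithmeticSubgroup → (quasiSplit F E c 3).arithmeticSubgroup → ℂ := fun γ δ =>
    f (x⁻¹ * ((γ : (quasiSplit F E c 3).arithmeticSubgroup) : (quasiSplit F E c 3).Adelic) * x) *
      (1 - (if T < borelHeight (((δ : (quasiSplit F E c 3).arithmeticSubgroup) : (quasiSplit F E c 3).Adelic) * x)
              then (1 : ℂ) else 0) -
           (if T < borelHeight ((((⟨(quasiSplit F E c 3).toAdelic w, w, rfl⟩ * δ :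
              (quasiSplit F E c 3).arithmeticSubgroup)) : (quasiSplit F E c 3).Adelic) * x) then (1 : ℂ) else 0))
    with hΦ
  have hwδ : ∀ δ : (quasiSplit F E c 3).arithmeticSubgroup,
      ((((⟨(quasiSplit F E c 3).toAdelic w, w, rfl⟩ * δ : (quasiSplit F E c 3).arithmeticSubgroup)) :
        (quasiSplit F E c 3).Adelic) * x) =
        (quasiSplit F E c 3).toAdelic w * (((δ : (quasiSplit F E c 3).arithmeticSubgroup) :
          (quasiSplit F E c 3).Adelic) * x) := fun δ => by
    rw [Subgroup.coe_mul, mul_assoc]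
  have hΦinv : ∀ (δ : (quasiSplit F E c 3).arithmeticSubgroup), ∀ l ∈ Subgroup.centralizer
      {(⟨(quasiSplit F E c 3).toAdelic g₀, g₀, rfl⟩ : (quasiSplit F E c 3).arithmeticSubgroup)},
      Φ (δ⁻¹ * ⟨(quasiSplit F E c 3).toAdelic g₀, g₀, rfl⟩ * δ) (l * δ) =
        Φ (δ⁻¹ * ⟨(quasiSplit F E c 3).toAdelic g₀, g₀, rfl⟩ * δ) δ := by
    intro δ l hl
    simp only [hΦ]
    rw [hwδ, hwδ]
    simp only [Subgroup.coe_mul, mul_assoc]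
    rw [jWeight_mul_eq_of_mem_centralizer hc ha hb hg₀ hw hl T _]
  have key := tsum_fiber_eq_tsum_quotient_centralizer hcl hi sec hsec Φ hΦinv
  simp only [hΦ] at key
  rw [key]
  refine tsum_congr fun q => ?_
  rw [hwδ]
  congr 2
  rw [Subgroup.coe_mul, Subgroup.coe_mul, Subgroup.coe_inv]
  change x⁻¹ * ((((q.out : (quasiSplit F E c 3).arithmeticSubgroup)) : (quasiSplit F E c 3).Adelic)⁻¹ *
      (quasiSplit F E c 3).toAdelic g₀ * (((q.out : (quasiSplit F E c 3).arithmeticSubgroup)) :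
        (quasiSplit F E c 3).Adelic)) * x = _
  group

/-- **THE `[0, ∞]` MAJORANT OF THE `j`-KERNEL AS A COSET SUM**: the same re-indexing for
`‖f(x⁻¹γ′x)‖ₑ · ‖1 − [T<H(sec γ′ x)] − [T<H(w♯ sec γ′ x)]‖ₑ` (the integrand whose quotient integral controls absolute
convergence). [cite: Rogawski1990, §6.1 (6.1.1)] [cite: Arthur1978TraceFormulaI, §8] -/
theorem tsum_fiber_jKernel_enorm_eq_tsum_quotient (hc : c * c = 1) {a b : Eˣ} (ha : c (a : E) * (a : E) ≠ 1)
    (hb : c (b : E) * (b : E) = 1) {g₀ w : (quasiSplit F E c 3).Rational}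
    (hg₀ : ((g₀.1 : GL (Fin 3) E) : Matrix (Fin 3) (Fin 3) E) = !![(a : E), 0, 0; 0, b, 0; 0, 0, (c (a : E))⁻¹])
    (hw : ((w.1 : GL (Fin 3) E) : Matrix (Fin 3) (Fin 3) E) = !![(0 : E), 0, 1; 0, 1, 0; 1, 0, 0])
    {ι : Type*} {cl : (quasiSplit F E c 3).arithmeticSubgroup → ι} (hcl : IsConjInvariant cl) {i : ι}
    (hi : cl ⟨(quasiSplit F E c 3).toAdelic g₀, g₀, rfl⟩ = i)
    (sec : cl ⁻¹' {i} → (quasiSplit F E c 3).arithmeticSubgroup)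
    (hsec : ∀ γ : cl ⁻¹' {i},
      (sec γ)⁻¹ * ⟨(quasiSplit F E c 3).toAdelic g₀, g₀, rfl⟩ * sec γ = (γ : (quasiSplit F E c 3).arithmeticSubgroup))
    (f : (quasiSplit F E c 3).Adelic → ℂ) (T : ℝ≥0) (x : (quasiSplit F E c 3).Adelic) :
    (∑' γ : cl ⁻¹' {i},
        ‖f (x⁻¹ * ((γ : (quasiSplit F E c 3).arithmeticSubgroup) : (quasiSplit F E c 3).Adelic) * x)‖ₑ *
          ‖(1 - (if T < borelHeight (((sec γ : (quasiSplit F E c 3).arithmeticSubgroup) : (quasiSplit F E c 3).Adelic) * x)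
                  then (1 : ℂ) else 0) -
               (if T < borelHeight ((((⟨(quasiSplit F E c 3).toAdelic w, w, rfl⟩ * sec γ :
                  (quasiSplit F E c 3).arithmeticSubgroup)) : (quasiSplit F E c 3).Adelic) * x) then (1 : ℂ) else 0))‖ₑ) =
      ∑' q : Quotient (QuotientGroup.rightRel (Subgroup.centralizer
          {(⟨(quasiSplit F E c 3).toAdelic g₀, g₀, rfl⟩ : (quasiSplit F E c 3).arithmeticSubgroup)})),
        ‖f (((((q.out : (quasiSplit F E c 3).arithmeticSubgroup)) : (quasiSplit F E c 3).Adelic) * x)⁻¹ *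
            (quasiSplit F E c 3).toAdelic g₀ *
            ((((q.out : (quasiSplit F E c 3).arithmeticSubgroup)) : (quasiSplit F E c 3).Adelic) * x))‖ₑ *
          ‖((1 : ℂ) - (if T < borelHeight ((((q.out : (quasiSplit F E c 3).arithmeticSubgroup)) :
                (quasiSplit F E c 3).Adelic) * x) then (1 : ℂ) else 0) -
            (if T < borelHeight ((quasiSplit F E c 3).toAdelic w *
                ((((q.out : (quasiSplit F E c 3).arithmeticSubgroup)) : (quasiSplit F E c 3).Adelic) * x))
              then (1 : ℂ) else 0))‖ₑ := by
  set Φ : (quasiSplit F E c 3).arithmeticSubgroup → (quasiSplit F E c 3).arithmeticSubgroup → ℝ≥0∞ := fun γ δ =>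
    ‖f (x⁻¹ * ((γ : (quasiSplit F E c 3).arithmeticSubgroup) : (quasiSplit F E c 3).Adelic) * x)‖ₑ *
      ‖(1 - (if T < borelHeight (((δ : (quasiSplit F E c 3).arithmeticSubgroup) : (quasiSplit F E c 3).Adelic) * x)
              then (1 : ℂ) else 0) -
           (if T < borelHeight ((((⟨(quasiSplit F E c 3).toAdelic w, w, rfl⟩ * δ :
              (quasiSplit F E c 3).arithmeticSubgroup)) : (quasiSplit F E c 3).Adelic) * x) then (1 : ℂ) else 0))‖ₑ
    with hΦ
  have hwδ : ∀ δ : (quasiSplit F E c 3).arithmeticSubgroup,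
      ((((⟨(quasiSplit F E c 3).toAdelic w, w, rfl⟩ * δ : (quasiSplit F E c 3).arithmeticSubgroup)) :
        (quasiSplit F E c 3).Adelic) * x) =
        (quasiSplit F E c 3).toAdelic w * (((δ : (quasiSplit F E c 3).arithmeticSubgroup) :
          (quasiSplit F E c 3).Adelic) * x) := fun δ => by
    rw [Subgroup.coe_mul, mul_assoc]
  have hΦinv : ∀ (δ : (quasiSplit F E c 3).arithmeticSubgroup), ∀ l ∈ Subgroup.centralizer
      {(⟨(quasiSplit F E c 3).toAdelic g₀, g₀, rfl⟩ : (quasiSplit F E c 3).arithmeticSubgroup)},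
      Φ (δ⁻¹ * ⟨(quasiSplit F E c 3).toAdelic g₀, g₀, rfl⟩ * δ) (l * δ) =
        Φ (δ⁻¹ * ⟨(quasiSplit F E c 3).toAdelic g₀, g₀, rfl⟩ * δ) δ := by
    intro δ l hl
    simp only [hΦ]
    rw [hwδ, hwδ]
    simp only [Subgroup.coe_mul, mul_assoc]
    rw [jWeight_mul_eq_of_mem_centralizer hc ha hb hg₀ hw hl T _]
  have key := tsum_fiber_eq_tsum_quotient_centralizer hcl hi sec hsec Φ hΦinv
  simp only [hΦ] at key
  rw [key]
  refine tsum_congr fun q => ?_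
  rw [hwδ]
  congr 3
  rw [Subgroup.coe_mul, Subgroup.coe_mul, Subgroup.coe_inv]
  change x⁻¹ * ((((q.out : (quasiSplit F E c 3).arithmeticSubgroup)) : (quasiSplit F E c 3).Adelic)⁻¹ *
      (quasiSplit F E c 3).toAdelic g₀ * (((q.out : (quasiSplit F E c 3).arithmeticSubgroup)) :
        (quasiSplit F E c 3).Adelic)) * x = _
  group

/-- **THE DESCENDED `j`-KERNEL IS THE COSET SUM OF ★ FILE A**: on the automorphic quotient `X = G(𝔸_F) ⧸ G(F)` the
function `[g] ↦ J_T(g⁻¹)` (★ `AdelicGroupData.quotFun`, the dictionary of ★ `truncatedTraceClass_def`) attached to the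
`j`-kernel `J_T(y) = Σ'_{γ′ ∈ 𝔬} f(y⁻¹γ′y)·u_T(sec γ′ · y)` equals `x ↦ Σ'_{q ∈ G_γ(F)\G(F)} ψ_T(q̃ · x̃⁻¹)`, the integrand of
★ `lintegral_tsum_quotient_eq_unfoldingConstant_mul_lintegral` ∕ ★ `integrable_tsum_quotient_and_integral_eq_mul_integral_of_subgroup`
at `Λ := G_γ(F)`. [cite: Rogawski1990, §2.2 (p. 13) and §6.1 (6.1.1)] -/
theorem quotFun_jKernel_eq_tsum_quotient (hc : c * c = 1) {a b : Eˣ} (ha : c (a : E) * (a : E) ≠ 1)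
    (hb : c (b : E) * (b : E) = 1) {g₀ w : (quasiSplit F E c 3).Rational}
    (hg₀ : ((g₀.1 : GL (Fin 3) E) : Matrix (Fin 3) (Fin 3) E) = !![(a : E), 0, 0; 0, b, 0; 0, 0, (c (a : E))⁻¹])
    (hw : ((w.1 : GL (Fin 3) E) : Matrix (Fin 3) (Fin 3) E) = !![(0 : E), 0, 1; 0, 1, 0; 1, 0, 0])
    {ι : Type*} {cl : (quasiSplit F E c 3).arithmeticSubgroup → ι} (hcl : IsConjInvariant cl) {i : ι}
    (hi : cl ⟨(quasiSplit F E c 3).toAdelic g₀, g₀, rfl⟩ = i)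
    (sec : cl ⁻¹' {i} → (quasiSplit F E c 3).arithmeticSubgroup)
    (hsec : ∀ γ : cl ⁻¹' {i},
      (sec γ)⁻¹ * ⟨(quasiSplit F E c 3).toAdelic g₀, g₀, rfl⟩ * sec γ = (γ : (quasiSplit F E c 3).arithmeticSubgroup))
    (f : (quasiSplit F E c 3).Adelic → ℂ) (T : ℝ≥0) (x : (quasiSplit F E c 3).automorphicQuotient) :
    (quasiSplit F E c 3).quotFun (fun y => ∑' γ : cl ⁻¹' {i},
        f (y⁻¹ * ((γ : (quasiSplit F E c 3).arithmeticSubgroup) : (quasiSplit F E c 3).Adelic) * y) *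
          (1 - (if T < borelHeight (((sec γ : (quasiSplit F E c 3).arithmeticSubgroup) : (quasiSplit F E c 3).Adelic) * y)
                  then (1 : ℂ) else 0) -
               (if T < borelHeight ((((⟨(quasiSplit F E c 3).toAdelic w, w, rfl⟩ * sec γ :
                  (quasiSplit F E c 3).arithmeticSubgroup)) : (quasiSplit F E c 3).Adelic) * y) then (1 : ℂ) else 0))) x =
      ∑' q : Quotient (QuotientGroup.rightRel (Subgroup.centralizer
          {(⟨(quasiSplit F E c 3).toAdelic g₀, g₀, rfl⟩ : (quasiSplit F E c 3).arithmeticSubgroup)})),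
        f (((((q.out : (quasiSplit F E c 3).arithmeticSubgroup)) : (quasiSplit F E c 3).Adelic) *
              (Quotient.out x : (quasiSplit F E c 3).Adelic)⁻¹)⁻¹ *
            (quasiSplit F E c 3).toAdelic g₀ *
            ((((q.out : (quasiSplit F E c 3).arithmeticSubgroup)) : (quasiSplit F E c 3).Adelic) *
              (Quotient.out x : (quasiSplit F E c 3).Adelic)⁻¹)) *
          ((1 : ℂ) - (if T < borelHeight ((((q.out : (quasiSplit F E c 3).arithmeticSubgroup)) :
                (quasiSplit F E c 3).Adelic) * (Quotient.out x : (quasiSplit F E c 3).Adelic)⁻¹) then (1 : ℂ) else 0) -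
            (if T < borelHeight ((quasiSplit F E c 3).toAdelic w *
                ((((q.out : (quasiSplit F E c 3).arithmeticSubgroup)) : (quasiSplit F E c 3).Adelic) *
                  (Quotient.out x : (quasiSplit F E c 3).Adelic)⁻¹)) then (1 : ℂ) else 0)) :=
  tsum_fiber_jKernel_eq_tsum_quotient hc ha hb hg₀ hw hcl hi sec hsec f T
    (Quotient.out x : (quasiSplit F E c 3).Adelic)⁻¹

end JKernel

/-! ## §3–§4 The unfolding over `G_γ(F)\G(𝔸_F)` -/

section Unfold

variable [MeasurableSpace (quasiSplit F E c 3).Adelic] [BorelSpace (quasiSplit F E c 3).Adelic]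

/-- Measurability of the orbital integrand `g ↦ f(g⁻¹ γ g)` of a Borel `f` (plumbing). [folklore] -/
private theorem measurable_comp_conj {f : (quasiSplit F E c 3).Adelic → ℂ} (hfm : Measurable f)
    (γ : (quasiSplit F E c 3).Adelic) : Measurable fun g : (quasiSplit F E c 3).Adelic => f (g⁻¹ * γ * g) :=
  hfm.comp (((continuous_id.inv.mul continuous_const).mul continuous_id).measurable)

/-- Measurability of Arthur's weight `g ↦ 1 − [T<H(g)] − [T<H(w♯g)]` (the Borel height is continuous ★
`continuous_borelHeight`; plumbing). [folklore] -/
private theorem measurable_jWeight (wA : (quasiSplit F E c 3).Adelic) (T : ℝ≥0) :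
    Measurable fun g : (quasiSplit F E c 3).Adelic =>
      ((1 : ℂ) - (if T < borelHeight g then (1 : ℂ) else 0) - (if T < borelHeight (wA * g) then (1 : ℂ) else 0)) := by
  have h1 : Measurable fun g : (quasiSplit F E c 3).Adelic => (if T < borelHeight g then (1 : ℂ) else 0) :=
    Measurable.ite (measurableSet_setOf_lt_borelHeight T) measurable_const measurable_const
  have h2 : Measurable fun g : (quasiSplit F E c 3).Adelic => (if T < borelHeight (wA * g) then (1 : ℂ) else 0) := by
    have hm : Measurable fun g : (quasiSplit F E c 3).Adelic => wA * g := (continuous_const.mul continuous_id).measurable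
    exact Measurable.ite ((measurableSet_setOf_lt_borelHeight T).preimage hm) measurable_const measurable_const
  exact (measurable_const.sub h1).sub h2

/-- **`[0, ∞]` UNFOLDING OF THE `j`-KERNEL'S MAJORANT** (`[0, ∞]` first): for an automorphic measure `μ` on
`X = G(𝔸_F) ⧸ G(F)`, an inversion-invariant Haar measure `ν_G` of `G(𝔸_F)`, a Borel `f` and every covering weight `β` of
`G_γ(F)♯ = G_γ(F) ≤ G(𝔸_F)`:
`∫⁻_X Σ'_{γ′ ∈ 𝔬} ‖f(x̃ γ′ x̃⁻¹)‖ₑ·‖u_T(sec γ′ · x̃⁻¹)‖ₑ dμ(x) = c_μ · ∫⁻_{G(𝔸)} β(g)·‖f(g⁻¹γ♯g)‖ₑ·‖u_T(g)‖ₑ dν_G(g)`,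
`c_μ = unfoldingConstant G(F) count μ ν_G` — so the descended `j`-kernel is absolutely integrable iff the right-hand side
is finite (`c_μ ≠ 0`, ★ `unfoldingConstant_quotientSubgroup_count_ne_zero`). §2 re-indexing + ★ FILE A
`lintegral_tsum_quotient_eq_unfoldingConstant_mul_lintegral` at `Λ := G_γ(F)`, the integrand `‖f(y⁻¹γ♯y)‖ₑ‖u_T(y)‖ₑ` being
left-`G_γ(F)`-invariant by §1. [cite: Rogawski1990, §6.1 (6.1.1)] [cite: Arthur1978TraceFormulaI, §8]
[cite: Gelbart1975, §9.B (9.40)–(9.45)] -/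
theorem lintegral_jKernel_enorm_eq_unfoldingConstant_mul_lintegral (hc : c * c = 1) {a b : Eˣ}
    (ha : c (a : E) * (a : E) ≠ 1) (hb : c (b : E) * (b : E) = 1) {g₀ w : (quasiSplit F E c 3).Rational}
    (hg₀ : ((g₀.1 : GL (Fin 3) E) : Matrix (Fin 3) (Fin 3) E) = !![(a : E), 0, 0; 0, b, 0; 0, 0, (c (a : E))⁻¹])
    (hw : ((w.1 : GL (Fin 3) E) : Matrix (Fin 3) (Fin 3) E) = !![(0 : E), 0, 1; 0, 1, 0; 1, 0, 0])
    (μ : Measure (quasiSplit F E c 3).automorphicQuotient) [(quasiSplit F E c 3).IsAutomorphicMeasure μ]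
    (νG : Measure (quasiSplit F E c 3).Adelic) [νG.IsHaarMeasure] [νG.IsInvInvariant]
    {ι : Type*} {cl : (quasiSplit F E c 3).arithmeticSubgroup → ι} (hcl : IsConjInvariant cl) {i : ι}
    (hi : cl ⟨(quasiSplit F E c 3).toAdelic g₀, g₀, rfl⟩ = i)
    (sec : cl ⁻¹' {i} → (quasiSplit F E c 3).arithmeticSubgroup)
    (hsec : ∀ γ : cl ⁻¹' {i},
      (sec γ)⁻¹ * ⟨(quasiSplit F E c 3).toAdelic g₀, g₀, rfl⟩ * sec γ = (γ : (quasiSplit F E c 3).arithmeticSubgroup))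
    {f : (quasiSplit F E c 3).Adelic → ℂ} (hfm : Measurable f) (T : ℝ≥0)
    {β : (quasiSplit F E c 3).Adelic → ℝ≥0∞}
    (hβ : IsCoveringWeight ((Subgroup.centralizer
      {(⟨(quasiSplit F E c 3).toAdelic g₀, g₀, rfl⟩ : (quasiSplit F E c 3).arithmeticSubgroup)}).map
        (quasiSplit F E c 3).arithmeticSubgroup.subtype) β) :
    haveI := t2Space_adeleRing_of_numberField E
    haveI := locallyCompactSpace_adeleRing' E
    haveI := secondCountableTopology_adeleRing E
    haveI : T2Space (quasiSplit F E c 3).Adelic :=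
      inferInstanceAs (T2Space (adelic F E c 3 ((StdForm.antidiagonal 3).over E)))
    haveI : LocallyCompactSpace (quasiSplit F E c 3).Adelic :=
      inferInstanceAs (LocallyCompactSpace (adelic F E c 3 ((StdForm.antidiagonal 3).over E)))
    haveI : SecondCountableTopology (quasiSplit F E c 3).Adelic :=
      inferInstanceAs (SecondCountableTopology (adelic F E c 3 ((StdForm.antidiagonal 3).over E)))
    haveI : DiscreteTopology (quasiSplit F E c 3).quotientSubgroup := by
      rw [quotientSubgroup_quasiSplit]; exact isDiscreteRational_quasiSplit
    letI := AdelicGroupData.measurableSpaceQuotientForm (quasiSplit F E c 3)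
    haveI := AdelicGroupData.borelSpaceQuotientForm (quasiSplit F E c 3)
    haveI := AdelicGroupData.smulInvariantMeasureQuotientForm (quasiSplit F E c 3) μ
    haveI := AdelicGroupData.isFiniteMeasureOnCompactsQuotientForm (quasiSplit F E c 3) μ
    ∫⁻ x, (∑' γ : cl ⁻¹' {i},
        ‖f (((Quotient.out x : (quasiSplit F E c 3).Adelic)⁻¹)⁻¹ *
              ((γ : (quasiSplit F E c 3).arithmeticSubgroup) : (quasiSplit F E c 3).Adelic) *
              (Quotient.out x : (quasiSplit F E c 3).Adelic)⁻¹)‖ₑ *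
          ‖(1 - (if T < borelHeight (((sec γ : (quasiSplit F E c 3).arithmeticSubgroup) : (quasiSplit F E c 3).Adelic) *
                  (Quotient.out x : (quasiSplit F E c 3).Adelic)⁻¹) then (1 : ℂ) else 0) -
               (if T < borelHeight ((((⟨(quasiSplit F E c 3).toAdelic w, w, rfl⟩ * sec γ :
                  (quasiSplit F E c 3).arithmeticSubgroup)) : (quasiSplit F E c 3).Adelic) *
                  (Quotient.out x : (quasiSplit F E c 3).Adelic)⁻¹) then (1 : ℂ) else 0))‖ₑ) ∂μ =
      (unfoldingConstant (quasiSplit F E c 3).quotientSubgroup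
          (count : Measure (quasiSplit F E c 3).quotientSubgroup) μ νG : ℝ≥0∞) *
        ∫⁻ g, β g * (‖f (g⁻¹ * (quasiSplit F E c 3).toAdelic g₀ * g)‖ₑ *
          ‖((1 : ℂ) - (if T < borelHeight g then (1 : ℂ) else 0) -
            (if T < borelHeight ((quasiSplit F E c 3).toAdelic w * g) then (1 : ℂ) else 0))‖ₑ) ∂νG := by
  -- the left-`G_γ(F)`-invariant integrand on the group
  set ψ : (quasiSplit F E c 3).Adelic → ℝ≥0∞ := fun g =>
    ‖f (g⁻¹ * (quasiSplit F E c 3).toAdelic g₀ * g)‖ₑ *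
      ‖((1 : ℂ) - (if T < borelHeight g then (1 : ℂ) else 0) -
        (if T < borelHeight ((quasiSplit F E c 3).toAdelic w * g) then (1 : ℂ) else 0))‖ₑ with hψ
  have hψm : Measurable ψ :=
    (measurable_comp_conj hfm _).enorm.mul (measurable_jWeight ((quasiSplit F E c 3).toAdelic w) T).enorm
  have hψinv : ∀ l ∈ Subgroup.centralizer
      {(⟨(quasiSplit F E c 3).toAdelic g₀, g₀, rfl⟩ : (quasiSplit F E c 3).arithmeticSubgroup)},
      ∀ y : (quasiSplit F E c 3).Adelic, ψ ((l : (quasiSplit F E c 3).Adelic) * y) = ψ y := by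
    intro l hl y
    simp only [hψ]
    have hcomm : (l : (quasiSplit F E c 3).Adelic) * (quasiSplit F E c 3).toAdelic g₀ =
        (quasiSplit F E c 3).toAdelic g₀ * (l : (quasiSplit F E c 3).Adelic) := by
      have h := Subgroup.mem_centralizer_singleton_iff.1 hl
      exact congrArg Subtype.val h
    have e0 : ((l : (quasiSplit F E c 3).Adelic))⁻¹ * (quasiSplit F E c 3).toAdelic g₀ *
        (l : (quasiSplit F E c 3).Adelic) = (quasiSplit F E c 3).toAdelic g₀ := by
      rw [mul_assoc, ← hcomm, inv_mul_cancel_left]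
    have e1 : ((l : (quasiSplit F E c 3).Adelic) * y)⁻¹ * (quasiSplit F E c 3).toAdelic g₀ *
        ((l : (quasiSplit F E c 3).Adelic) * y) = y⁻¹ * (quasiSplit F E c 3).toAdelic g₀ * y := by
      calc ((l : (quasiSplit F E c 3).Adelic) * y)⁻¹ * (quasiSplit F E c 3).toAdelic g₀ *
            ((l : (quasiSplit F E c 3).Adelic) * y)
          = y⁻¹ * (((l : (quasiSplit F E c 3).Adelic))⁻¹ * (quasiSplit F E c 3).toAdelic g₀ *
              (l : (quasiSplit F E c 3).Adelic)) * y := by group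
        _ = y⁻¹ * (quasiSplit F E c 3).toAdelic g₀ * y := by rw [e0]
    rw [e1, jWeight_mul_eq_of_mem_centralizer hc ha hb hg₀ hw hl T y]
  have key := lintegral_tsum_quotient_eq_unfoldingConstant_mul_lintegral μ νG hβ hψm hψinv
  simp only [hψ] at key
  rw [← key]
  refine lintegral_congr fun x => ?_
  rw [tsum_fiber_jKernel_enorm_eq_tsum_quotient hc ha hb hg₀ hw hcl hi sec hsec f T]

/-- **THE BOCHNER UNFOLDING OF THE `j`-KERNEL** (Rogawski (6.1.1): `J^T_𝔬(f)` → the weighted orbital integral over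
`M\G`, before the `A_M`-integration). Setting as in §3; assume
`hfin : ∫⁻ β(g)·‖f(g⁻¹γ♯g)·u_T(g)‖ₑ dν_G(g) < ∞` (discharged by the `T(𝔸)`-fibre step of the sequel). Then the descended
`j`-kernel `quotFun J_T`, `J_T(y) = Σ'_{γ′ ∈ 𝔬} f(y⁻¹γ′y)·(1 − [T<H(sec γ′ y)] − [T<H(w♯ sec γ′ y)])` — the first summand of ★
`truncatedKernelClass_eq_tsum_mul_weight_sub_sum_of_hyperbolic` — is `μ`-integrable and
`∫_X quotFun J_T dμ = c_μ · ∫_{G(𝔸)} (β g).toReal • (f(g⁻¹γ♯g)·(1 − [T<H g] − [T<H(w♯g)])) dν_G(g)`,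
`c_μ = unfoldingConstant G(F) count μ ν_G` (★ LAW 4's constant). ★ FILE A
`integrable_tsum_quotient_and_integral_eq_mul_integral_of_subgroup` at `Λ := G_γ(F)` + §2.
[cite: Rogawski1990, §6.1 (6.1.1)] [cite: Arthur1978TraceFormulaI, §8] [cite: Gelbart1975, §9.B (9.40)–(9.45)] -/
theorem integrable_quotFun_jKernel_and_integral_eq_mul_integral (hc : c * c = 1) {a b : Eˣ}
    (ha : c (a : E) * (a : E) ≠ 1) (hb : c (b : E) * (b : E) = 1) {g₀ w : (quasiSplit F E c 3).Rational}
    (hg₀ : ((g₀.1 : GL (Fin 3) E) : Matrix (Fin 3) (Fin 3) E) = !![(a : E), 0, 0; 0, b, 0; 0, 0, (c (a : E))⁻¹])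
    (hw : ((w.1 : GL (Fin 3) E) : Matrix (Fin 3) (Fin 3) E) = !![(0 : E), 0, 1; 0, 1, 0; 1, 0, 0])
    (μ : Measure (quasiSplit F E c 3).automorphicQuotient) [(quasiSplit F E c 3).IsAutomorphicMeasure μ]
    (νG : Measure (quasiSplit F E c 3).Adelic) [νG.IsHaarMeasure] [νG.IsInvInvariant]
    {ι : Type*} {cl : (quasiSplit F E c 3).arithmeticSubgroup → ι} (hcl : IsConjInvariant cl) {i : ι}
    (hi : cl ⟨(quasiSplit F E c 3).toAdelic g₀, g₀, rfl⟩ = i)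
    (sec : cl ⁻¹' {i} → (quasiSplit F E c 3).arithmeticSubgroup)
    (hsec : ∀ γ : cl ⁻¹' {i},
      (sec γ)⁻¹ * ⟨(quasiSplit F E c 3).toAdelic g₀, g₀, rfl⟩ * sec γ = (γ : (quasiSplit F E c 3).arithmeticSubgroup))
    {f : (quasiSplit F E c 3).Adelic → ℂ} (hfm : Measurable f) (T : ℝ≥0)
    {β : (quasiSplit F E c 3).Adelic → ℝ≥0∞}
    (hβ : IsCoveringWeight ((Subgroup.centralizer
      {(⟨(quasiSplit F E c 3).toAdelic g₀, g₀, rfl⟩ : (quasiSplit F E c 3).arithmeticSubgroup)}).map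
        (quasiSplit F E c 3).arithmeticSubgroup.subtype) β)
    (hfin : ∫⁻ g, β g * ‖f (g⁻¹ * (quasiSplit F E c 3).toAdelic g₀ * g) *
        ((1 : ℂ) - (if T < borelHeight g then (1 : ℂ) else 0) -
          (if T < borelHeight ((quasiSplit F E c 3).toAdelic w * g) then (1 : ℂ) else 0))‖ₑ ∂νG < ∞) :
    haveI := t2Space_adeleRing_of_numberField E
    haveI := locallyCompactSpace_adeleRing' E
    haveI := secondCountableTopology_adeleRing E
    haveI : T2Space (quasiSplit F E c 3).Adelic :=
      inferInstanceAs (T2Space (adelic F E c 3 ((StdForm.antidiagonal 3).over E)))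
    haveI : LocallyCompactSpace (quasiSplit F E c 3).Adelic :=
      inferInstanceAs (LocallyCompactSpace (adelic F E c 3 ((StdForm.antidiagonal 3).over E)))
    haveI : SecondCountableTopology (quasiSplit F E c 3).Adelic :=
      inferInstanceAs (SecondCountableTopology (adelic F E c 3 ((StdForm.antidiagonal 3).over E)))
    haveI : DiscreteTopology (quasiSplit F E c 3).quotientSubgroup := by
      rw [quotientSubgroup_quasiSplit]; exact isDiscreteRational_quasiSplit
    letI := AdelicGroupData.measurableSpaceQuotientForm (quasiSplit F E c 3)
    haveI := AdelicGroupData.borelSpaceQuotientForm (quasiSplit F E c 3)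
    haveI := AdelicGroupData.smulInvariantMeasureQuotientForm (quasiSplit F E c 3) μ
    haveI := AdelicGroupData.isFiniteMeasureOnCompactsQuotientForm (quasiSplit F E c 3) μ
    Integrable ((quasiSplit F E c 3).quotFun (fun y => ∑' γ : cl ⁻¹' {i},
        f (y⁻¹ * ((γ : (quasiSplit F E c 3).arithmeticSubgroup) : (quasiSplit F E c 3).Adelic) * y) *
          (1 - (if T < borelHeight (((sec γ : (quasiSplit F E c 3).arithmeticSubgroup) : (quasiSplit F E c 3).Adelic) * y)
                  then (1 : ℂ) else 0) -
               (if T < borelHeight ((((⟨(quasiSplit F E c 3).toAdelic w, w, rfl⟩ * sec γ :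
                  (quasiSplit F E c 3).arithmeticSubgroup)) : (quasiSplit F E c 3).Adelic) * y) then (1 : ℂ) else 0)))) μ ∧
      ∫ x, (quasiSplit F E c 3).quotFun (fun y => ∑' γ : cl ⁻¹' {i},
        f (y⁻¹ * ((γ : (quasiSplit F E c 3).arithmeticSubgroup) : (quasiSplit F E c 3).Adelic) * y) *
          (1 - (if T < borelHeight (((sec γ : (quasiSplit F E c 3).arithmeticSubgroup) : (quasiSplit F E c 3).Adelic) * y)
                  then (1 : ℂ) else 0) -
               (if T < borelHeight ((((⟨(quasiSplit F E c 3).toAdelic w, w, rfl⟩ * sec γ :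
                  (quasiSplit F E c 3).arithmeticSubgroup)) : (quasiSplit F E c 3).Adelic) * y) then (1 : ℂ) else 0))) x ∂μ =
        ((unfoldingConstant (quasiSplit F E c 3).quotientSubgroup
            (count : Measure (quasiSplit F E c 3).quotientSubgroup) μ νG : ℝ) : ℂ) *
          ∫ g, (β g).toReal • (f (g⁻¹ * (quasiSplit F E c 3).toAdelic g₀ * g) *
            ((1 : ℂ) - (if T < borelHeight g then (1 : ℂ) else 0) -
              (if T < borelHeight ((quasiSplit F E c 3).toAdelic w * g) then (1 : ℂ) else 0))) ∂νG := by
  -- the left-`G_γ(F)`-invariant integrand on the group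
  set ψ : (quasiSplit F E c 3).Adelic → ℂ := fun g =>
    f (g⁻¹ * (quasiSplit F E c 3).toAdelic g₀ * g) *
      ((1 : ℂ) - (if T < borelHeight g then (1 : ℂ) else 0) -
        (if T < borelHeight ((quasiSplit F E c 3).toAdelic w * g) then (1 : ℂ) else 0)) with hψ
  have hψm : Measurable ψ :=
    (measurable_comp_conj hfm _).mul (measurable_jWeight ((quasiSplit F E c 3).toAdelic w) T)
  have hψinv : ∀ l ∈ Subgroup.centralizer
      {(⟨(quasiSplit F E c 3).toAdelic g₀, g₀, rfl⟩ : (quasiSplit F E c 3).arithmeticSubgroup)},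
      ∀ y : (quasiSplit F E c 3).Adelic, ψ ((l : (quasiSplit F E c 3).Adelic) * y) = ψ y := by
    intro l hl y
    simp only [hψ]
    have hcomm : (l : (quasiSplit F E c 3).Adelic) * (quasiSplit F E c 3).toAdelic g₀ =
        (quasiSplit F E c 3).toAdelic g₀ * (l : (quasiSplit F E c 3).Adelic) := by
      have h := Subgroup.mem_centralizer_singleton_iff.1 hl
      exact congrArg Subtype.val h
    have e0 : ((l : (quasiSplit F E c 3).Adelic))⁻¹ * (quasiSplit F E c 3).toAdelic g₀ *
        (l : (quasiSplit F E c 3).Adelic) = (quasiSplit F E c 3).toAdelic g₀ := by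
      rw [mul_assoc, ← hcomm, inv_mul_cancel_left]
    have e1 : ((l : (quasiSplit F E c 3).Adelic) * y)⁻¹ * (quasiSplit F E c 3).toAdelic g₀ *
        ((l : (quasiSplit F E c 3).Adelic) * y) = y⁻¹ * (quasiSplit F E c 3).toAdelic g₀ * y := by
      calc ((l : (quasiSplit F E c 3).Adelic) * y)⁻¹ * (quasiSplit F E c 3).toAdelic g₀ *
            ((l : (quasiSplit F E c 3).Adelic) * y)
          = y⁻¹ * (((l : (quasiSplit F E c 3).Adelic))⁻¹ * (quasiSplit F E c 3).toAdelic g₀ *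
              (l : (quasiSplit F E c 3).Adelic)) * y := by group
        _ = y⁻¹ * (quasiSplit F E c 3).toAdelic g₀ * y := by rw [e0]
    rw [e1, jWeight_mul_eq_of_mem_centralizer hc ha hb hg₀ hw hl T y]
  have hint : ∫⁻ g, β g * ‖ψ g‖ₑ ∂νG < ∞ := by simpa only [hψ] using hfin
  obtain ⟨h1, h2⟩ := integrable_tsum_quotient_and_integral_eq_mul_integral_of_subgroup μ νG hβ hψm hψinv hint
  -- the descended `j`-kernel is that coset sum, pointwise
  have hpt : (quasiSplit F E c 3).quotFun (fun y => ∑' γ : cl ⁻¹' {i},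
        f (y⁻¹ * ((γ : (quasiSplit F E c 3).arithmeticSubgroup) : (quasiSplit F E c 3).Adelic) * y) *
          (1 - (if T < borelHeight (((sec γ : (quasiSplit F E c 3).arithmeticSubgroup) : (quasiSplit F E c 3).Adelic) * y)
                  then (1 : ℂ) else 0) -
               (if T < borelHeight ((((⟨(quasiSplit F E c 3).toAdelic w, w, rfl⟩ * sec γ :
                  (quasiSplit F E c 3).arithmeticSubgroup)) : (quasiSplit F E c 3).Adelic) * y) then (1 : ℂ) else 0))) =
      fun x => ∑' q : Quotient (QuotientGroup.rightRel (Subgroup.centralizer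
          {(⟨(quasiSplit F E c 3).toAdelic g₀, g₀, rfl⟩ : (quasiSplit F E c 3).arithmeticSubgroup)})),
        ψ ((((q.out : (quasiSplit F E c 3).arithmeticSubgroup)) : (quasiSplit F E c 3).Adelic) *
          (Quotient.out x : (quasiSplit F E c 3).Adelic)⁻¹) := by
    funext x
    rw [quotFun_jKernel_eq_tsum_quotient hc ha hb hg₀ hw hcl hi sec hsec f T x]
  rw [hpt]
  exact ⟨h1, h2⟩

end Unfold

end UnitaryGroup

end Literature.NumberTheory.Automorphic
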